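import Summits.QuantumFields.YangMills.Theorems.CoarseStiffnessTailCappedCoarseStiffnessLAbelianFlatLowerBound

/-!
# Route `CoarseStiffnessTail` — THE EXACT-EXPONENT LOWER BOUND: `Z_P(β) ≥ e^{−13d²|T|}·haar(B_τ)^{(d−1)(|T|−1)}·Haar^{⊗d}(Comm_τ)`, `τ = β^{−1/2}`
# (lead's certificate, seat `ym-line-cst-p1` g15; helper on 25301 `CappedCoarseStiffnessL`, stub S3 = uniform mean action, P2/(R5))

THE THEOREM (`partitionFn_ge_commBox`, `G = SU(N)`, every `Params`, `β ≥ 1`, `τ = β^{−1/2}`, `B_τ` the operator ball):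

  `exp(−(25/2)·d²·|T|) · haar(B_τ)^{(d−1)(|T|−1)} · Haar^{⊗d}{a⃗ ∈ G^d : |[a_k, a_l] − 1| ≤ τ ∀ k,l} ≤ Z_P(β)`.

With the tree's `haar(B_τ) ≥ e^{−C_N} τ^{N²−1}` this carries `(N²−1)/2·(d−1)(|T|−1)` powers of `β⁻¹` — the SAME count as the corner-comb upper
bound (`…LSharpUpperBound`) — times the Haar volume of the `τ`-ALMOST-COMMUTING `d`-TUPLES; for `d = 3`, `SU(2)` the latter is `≍ τ⁴ = β^{−2}`,
matching the decay of the commuting-triple integral on the upper side: the torus sandwich becomes exact up to `e^{O(|T|)}`.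

PROOF (the g15 abelian-flat box with the `d` CORNER BONDS FREE).  Gauge the full comb tree (`…LCombTreeGauge`).  For `a⃗ ∈ G^d` let
`S(a⃗) = {U : a_{k}⁻¹U_b ∈ B_τ for every wrapping bond b of direction k, U_b ∈ B_τ otherwise}`; on `S(a⃗)` every plaquette is
`(s y₁)(t y₂)(s y₃)⁻¹(t y₄)⁻¹` with `s, t ∈ {1} ∪ {a_k}` and `|y_i − 1| ≤ τ`, so `|U(∂p) − 1| ≤ |[s,t] − 1| + 4τ ≤ 5τ` when `a⃗` is
`τ`-almost-commuting (`dist1_word_le_comm`), i.e. `A ≤ (25/2)τ²·#plaq`.  Averaging `Φ(a⃗,U) = 1_{Comm_τ}(a⃗)·Π_b 1_B(σ_b(a⃗)⁻¹U_b)`: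
`∫Φ dU = 1_{Comm_τ}(a⃗)·haar(B)^{#bonds}`, `∫Φ da⃗ ≤ haar(B)^d` (the `d` corner bonds), tree bonds never wrap; Tonelli as in
`…LAbelianFlatLowerBound`: `e^{−(25/2)βτ²#plaq}·haar(B)^{#bonds}·Haar^{⊗d}(Comm_τ) ≤ haar(B)^{d}·haar(B)^{|T|−1}·Z`.

HONEST SCOPE.  Elementary; the lower bound `Haar^{⊗3}(Comm_τ) ≥ c·τ⁴` on `SU(2)` is NOT proved here.  Nothing of Bałaban's is asserted; the crux
25301, its stubs S1/S2/S3, `HistoryTailL` 19936 stay OPEN; `YM3TorusSU2` (R3, RECORD rung, not Clay) is NOT proved; the Yang–Mills mass gap is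
NOT touched.

References: T. Bałaban, CMP **109** (1987) 249–301 [Balaban1987RG1] ((0.14)–(0.16) pp.254–255); I. Montvay, G. Münster, *Quantum Fields on
a Lattice* (1994) §3.2.5 [MontvayMunster1994].
-/

noncomputable section

open MeasureTheory
open scoped BigOperators

namespace Summit.QuantumFields.YangMills.Theorems.CoarseStiffnessTailSharpLowerBound

open Literature.MathematicalPhysics.QuantumFieldTheory.Balaban1983to89
open Missing B16ZLower T4StabilityFloorUnitary
open Summit.QuantumFields.YangMills.BalabanUVNodes.N13GaugeFixingTargetDisjointBondFamily
  (integral_indicator_mul_left_eq_haarReal gaugeInvariant_boltzmann)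
open Summit.QuantumFields.YangMills.BalabanUVNodes.N13WilsonPartitionFnGaugeFixedLowerBound (card_plaq_le)
open Summit.QuantumFields.YangMills.BalabanUVNodes.N13GaugeFixingAxialLayers (shift_apply_ne)
open Summit.QuantumFields.YangMills.Theorems.CoarseStiffnessTailCombTreeGauge (pow_mul_integral_eq_prod_indicator_combTree card_combTree)
open Summit.QuantumFields.YangMills.Theorems.CoarseStiffnessTailAbelianFlatLowerBound (dist1_insert_le integral_indicator_inv_mul_eq_haarReal)

/-! ## §1 The word with a commutator -/

section Word

variable {G : Type*} [GaugeGroup G]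

/-- **THE WORD WITH A COMMUTATOR**: for ANY `s, t` and `y₁,…,y₄`,
`|(s y₁)(t y₂)(s y₃)⁻¹(t y₄)⁻¹ − 1| ≤ |s t s⁻¹ t⁻¹ − 1| + |y₁ − 1| + |y₂ − 1| + |y₃ − 1| + |y₄ − 1|`. [folklore] -/
theorem dist1_word_le_comm (s t y₁ y₂ y₃ y₄ : G) :
    dist1 ((s * y₁) * (t * y₂) * (s * y₃)⁻¹ * (t * y₄)⁻¹) ≤
      dist1 (s * t * s⁻¹ * t⁻¹) + dist1 y₁ + dist1 y₂ + dist1 y₃ + dist1 y₄ := by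
  calc dist1 ((s * y₁) * (t * y₂) * (s * y₃)⁻¹ * (t * y₄)⁻¹)
      = dist1 (s * y₁ * (t * y₂ * y₃⁻¹ * s⁻¹ * y₄⁻¹ * t⁻¹)) := by congr 1; group
    _ ≤ dist1 (s * (t * y₂ * y₃⁻¹ * s⁻¹ * y₄⁻¹ * t⁻¹)) + dist1 y₁ := dist1_insert_le _ _ _
    _ = dist1 ((s * t) * y₂ * (y₃⁻¹ * s⁻¹ * y₄⁻¹ * t⁻¹)) + dist1 y₁ := by congr 2; group
    _ ≤ dist1 ((s * t) * (y₃⁻¹ * s⁻¹ * y₄⁻¹ * t⁻¹)) + dist1 y₂ + dist1 y₁ := by linarith [dist1_insert_le (s * t) y₂ (y₃⁻¹ * s⁻¹ * y₄⁻¹ * t⁻¹)]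
    _ = dist1 ((s * t) * y₃⁻¹ * (s⁻¹ * y₄⁻¹ * t⁻¹)) + dist1 y₂ + dist1 y₁ := by congr 3; group
    _ ≤ dist1 ((s * t) * (s⁻¹ * y₄⁻¹ * t⁻¹)) + dist1 y₃⁻¹ + dist1 y₂ + dist1 y₁ := by linarith [dist1_insert_le (s * t) y₃⁻¹ (s⁻¹ * y₄⁻¹ * t⁻¹)]
    _ = dist1 ((s * t * s⁻¹) * y₄⁻¹ * t⁻¹) + dist1 y₃⁻¹ + dist1 y₂ + dist1 y₁ := by congr 4; group
    _ ≤ dist1 ((s * t * s⁻¹) * t⁻¹) + dist1 y₄⁻¹ + dist1 y₃⁻¹ + dist1 y₂ + dist1 y₁ := by linarith [dist1_insert_le (s * t * s⁻¹) y₄⁻¹ t⁻¹]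
    _ = dist1 (s * t * s⁻¹ * t⁻¹) + dist1 y₁ + dist1 y₂ + dist1 y₃ + dist1 y₄ := by
        rw [GaugeGroup.dist1_inv, GaugeGroup.dist1_inv]; ring

end Word

/-! ## §2 The box around the flat connections with τ-almost-commuting holonomies -/

section Box

variable (N : ℕ) [NeZero N] {P : Params}

/-- **THE ACTION ON THE COMMUTING BOX** (`G = SU(N)`): if `a⃗` is `τ`-almost commuting (`|[a_k,a_l] − 1| ≤ τ` for all `k, l`) and
`σ_b(a⃗)⁻¹·U_b ∈ B_τ` for every bond (`σ_b(a⃗) = a_{dir b}` if `b` wraps, `1` otherwise), then `A(U) ≤ (25/2)τ²·#plaquettes`. [folklore] -/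
theorem wilsonAction4_le_of_commBox {τ : ℝ} (a : Fin P.d → Matrix.specialUnitaryGroup (Fin N) ℂ)
    (ha : ∀ k l : Fin P.d, dist1 (a k * a l * (a k)⁻¹ * (a l)⁻¹) ≤ τ)
    {U : GaugeField P 0 (Matrix.specialUnitaryGroup (Fin N) ℂ)}
    (hU : ∀ b : PBond P 0, (if b.src b.dir = -1 then a b.dir else 1)⁻¹ * U b ∈ suOpBall N τ) :
    wilsonAction4 U ≤ 25 / 2 * τ ^ 2 * Fintype.card (Plaq P 0) := by
  rw [wilsonAction4_eq_sum]
  have hτ0 : 0 ≤ τ := by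
    obtain ⟨k⟩ : Nonempty (Fin P.d) := ⟨⟨0, P.hd⟩⟩
    have := ha k k
    exact (GaugeGroup.dist1_nonneg _).trans this
  have hy : ∀ b : PBond P 0, dist1 ((if b.src b.dir = -1 then a b.dir else 1)⁻¹ * U b) ≤ τ := fun b => mem_suOpBall_iff_dist1.1 (hU b)
  have hp : ∀ p : Plaq P 0, 1 - reTr (GaugeField.plaqHol U p) ≤ 25 / 2 * τ ^ 2 := by
    intro p
    set s : Matrix.specialUnitaryGroup (Fin N) ℂ := if p.src p.μ = -1 then a p.μ else 1 with hs
    set t : Matrix.specialUnitaryGroup (Fin N) ℂ := if p.src p.ν = -1 then a p.ν else 1 with ht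
    have hst : dist1 (s * t * s⁻¹ * t⁻¹) ≤ τ := by
      rw [hs, ht]; split_ifs
      · exact ha p.μ p.ν
      · simpa [GaugeGroup.dist1_one] using hτ0
      · simpa [GaugeGroup.dist1_one] using hτ0
      · simpa [GaugeGroup.dist1_one] using hτ0
    have hμν : p.μ ≠ p.ν := Fin.ne_of_lt p.hμν
    set y₁ := s⁻¹ * U ⟨p.src, p.μ⟩ with hy₁
    set y₂ := t⁻¹ * U ⟨p.src.shift p.μ, p.ν⟩ with hy₂
    set y₃ := s⁻¹ * U ⟨p.src.shift p.ν, p.μ⟩ with hy₃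
    set y₄ := t⁻¹ * U ⟨p.src, p.ν⟩ with hy₄
    have h3src : (p.src.shift p.ν) p.μ = p.src p.μ := shift_apply_ne P 0 _ _ _ hμν
    have h2src : (p.src.shift p.μ) p.ν = p.src p.ν := shift_apply_ne P 0 _ _ _ hμν.symm
    have hd₁ : dist1 y₁ ≤ τ := by have := hy ⟨p.src, p.μ⟩; rwa [← hs] at this
    have hd₂ : dist1 y₂ ≤ τ := by have := hy ⟨p.src.shift p.μ, p.ν⟩; simp only [h2src] at this; rwa [← ht] at this
    have hd₃ : dist1 y₃ ≤ τ := by have := hy ⟨p.src.shift p.ν, p.μ⟩; simp only [h3src] at this; rwa [← hs] at this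
    have hd₄ : dist1 y₄ ≤ τ := by have := hy ⟨p.src, p.ν⟩; rwa [← ht] at this
    have hhol : GaugeField.plaqHol U p = (s * y₁) * (t * y₂) * (s * y₃)⁻¹ * (t * y₄)⁻¹ := by
      unfold GaugeField.plaqHol
      rw [hy₁, hy₂, hy₃, hy₄]
      simp only [mul_inv_cancel_left]
    have hdist : dist1 (GaugeField.plaqHol U p) ≤ 5 * τ := by
      rw [hhol]
      linarith [dist1_word_le_comm s t y₁ y₂ y₃ y₄]
    have h1 := one_sub_reTr_le_half_dist1_sq_specialUnitary (N := N) (GaugeField.plaqHol U p)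
    have h3 : dist1 (GaugeField.plaqHol U p) ^ 2 ≤ (5 * τ) ^ 2 := pow_le_pow_left₀ (GaugeGroup.dist1_nonneg _) hdist 2
    nlinarith
  calc ∑ p, (1 - reTr (GaugeField.plaqHol U p)) ≤ ∑ _p : Plaq P 0, 25 / 2 * τ ^ 2 := Finset.sum_le_sum fun p _ => hp p
    _ = 25 / 2 * τ ^ 2 * Fintype.card (Plaq P 0) := by rw [Finset.sum_const, Finset.card_univ, nsmul_eq_mul, mul_comm]

end Box

/-! ## §3 Averaging over the free corner holonomies and the lower bound -/

section LowerBound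

variable (N : ℕ) [NeZero N]

/-- **★★★ THE EXACT-EXPONENT LOWER BOUND ON BAŁABAN's TORUS PARTITION FUNCTION, `G = SU(N)`.**  For every `Params` `P` and `β ≥ 1`, with
`τ = β^{−1/2}`, `B_τ` the operator ball and `Comm_τ = {a⃗ ∈ G^d : |a_k a_l a_k⁻¹ a_l⁻¹ − 1| ≤ τ ∀ k,l}`:
`exp(−(25/2)·d²·|T|) · haar(B_τ)^{(d−1)(|T|−1)} · Haar^{⊗d}(Comm_τ) ≤ Z_P(β)`. [folklore] -/
theorem partitionFn_ge_commBox (P : Params) {β : ℝ} (hβ : 1 ≤ β) :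
    Real.exp (-(25 / 2 * (P.d : ℝ) ^ 2 * (Fintype.card (Site P 0) : ℝ))) *
        (HaarData.haar : Measure (Matrix.specialUnitaryGroup (Fin N) ℂ)).real (suOpBall N (Real.sqrt β)⁻¹) ^
          ((P.d - 1) * (Fintype.card (Site P 0) - 1)) *
        (Measure.pi fun _ : Fin P.d => (HaarData.haar : Measure (Matrix.specialUnitaryGroup (Fin N) ℂ))).real
          {a | ∀ k l : Fin P.d, dist1 (a k * a l * (a k)⁻¹ * (a l)⁻¹) ≤ (Real.sqrt β)⁻¹} ≤
      partitionFn (G := Matrix.specialUnitaryGroup (Fin N) ℂ) P β := by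
  classical
  set G := Matrix.specialUnitaryGroup (Fin N) ℂ
  have hβ0 : 0 < β := lt_of_lt_of_le one_pos hβ
  set τ : ℝ := (Real.sqrt β)⁻¹ with hτdef
  have hsq : 0 < Real.sqrt β := Real.sqrt_pos.2 hβ0
  have hτ : 0 < τ := inv_pos.2 hsq
  have hτsq : τ ^ 2 = β⁻¹ := by rw [hτdef, inv_pow, Real.sq_sqrt hβ0.le]
  set B : Set G := suOpBall N τ with hBdef
  have hB : MeasurableSet B := measurableSet_suOpBall τ
  set c : ℝ := (HaarData.haar : Measure G).real B with hc
  have hcpos : 0 < c := haarReal_suOpBall_pos (N := N) hτ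
  haveI : IsProbabilityMeasure (HaarData.haar : Measure G) := HaarData.isProb
  haveI := isProbabilityMeasure_fieldMeasure (G := G) P 0
  set μd : Measure (Fin P.d → G) := Measure.pi fun _ : Fin P.d => (HaarData.haar : Measure G) with hμd
  haveI : IsProbabilityMeasure μd := by rw [hμd]; infer_instance
  set Comm : Set (Fin P.d → G) := {a | ∀ k l : Fin P.d, dist1 (a k * a l * (a k)⁻¹ * (a l)⁻¹) ≤ τ} with hComm
  have hCommM : MeasurableSet Comm := by
    have : Comm = ⋂ k : Fin P.d, ⋂ l : Fin P.d, {a : Fin P.d → G | dist1 (a k * a l * (a k)⁻¹ * (a l)⁻¹) ≤ τ} := by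
      ext a; simp [hComm]
    rw [this]
    refine MeasurableSet.iInter fun k => MeasurableSet.iInter fun l => ?_
    exact measurableSet_le (RegularGaugeGroup.measurable_dist1.comp
      ((((measurable_pi_apply k).mul (measurable_pi_apply l)).mul (measurable_pi_apply k).inv).mul (measurable_pi_apply l).inv))
      measurable_const
  -- (1) the comb-tree identity at the Boltzmann weight
  set Tr : Finset (PBond P 0) := Finset.univ.filter fun b : PBond P 0 =>
    (∀ i, i < b.dir → b.src i = 0) ∧ (b.src b.dir).val < P.sitesPerDir 0 - 1 with hTr
  have hid := pow_mul_integral_eq_prod_indicator_combTree P 0 hB (gaugeInvariant_boltzmann P β)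
    (integrable_boltzmann RegularGaugeGroup.measurable_reTr P hβ0.le)
  rw [← hTr] at hid
  -- (2) the averaged box function
  set σ : PBond P 0 → (Fin P.d → G) → G := fun b a => if b.src b.dir = -1 then a b.dir else 1 with hσ
  set Φ : (Fin P.d → G) → GaugeField P 0 G → ℝ := fun a U =>
    Comm.indicator (fun _ => (1 : ℝ)) a * ∏ b, B.indicator (fun _ => (1 : ℝ)) ((σ b a)⁻¹ * U b) with hΦ
  have hσmeas : ∀ b : PBond P 0, Measurable (σ b) := by
    intro b; simp only [hσ]; split_ifs
    · exact measurable_pi_apply _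
    · exact measurable_const
  have hind_nn : ∀ a, 0 ≤ Comm.indicator (fun _ => (1 : ℝ)) a := fun a => Set.indicator_nonneg (fun _ _ => zero_le_one) _
  have hind_le : ∀ a, Comm.indicator (fun _ => (1 : ℝ)) a ≤ 1 := fun a => Set.indicator_le_self' (fun _ _ => zero_le_one) _
  have hprod_nn : ∀ (a : Fin P.d → G) (U : GaugeField P 0 G), 0 ≤ ∏ b, B.indicator (fun _ => (1 : ℝ)) ((σ b a)⁻¹ * U b) := fun a U =>
    Finset.prod_nonneg fun b _ => Set.indicator_nonneg (fun _ _ => zero_le_one) _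
  have hprod_le : ∀ (a : Fin P.d → G) (U : GaugeField P 0 G), ∏ b, B.indicator (fun _ => (1 : ℝ)) ((σ b a)⁻¹ * U b) ≤ 1 := fun a U =>
    Finset.prod_le_one (fun b _ => Set.indicator_nonneg (fun _ _ => zero_le_one) _)
      fun b _ => Set.indicator_le_self' (fun _ _ => zero_le_one) _
  have hΦnn : ∀ (a : Fin P.d → G) (U : GaugeField P 0 G), 0 ≤ Φ a U := fun a U => mul_nonneg (hind_nn a) (hprod_nn a U)
  have hΦle : ∀ (a : Fin P.d → G) (U : GaugeField P 0 G), Φ a U ≤ 1 := fun a U => by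
    rw [hΦ]; exact mul_le_one₀ (hind_le a) (hprod_nn a U) (hprod_le a U)
  have hΦmeas : Measurable (Function.uncurry Φ) := by
    refine Measurable.mul ((measurable_const.indicator hCommM).comp measurable_fst) ?_
    refine Finset.measurable_prod _ fun b _ => ?_
    refine (measurable_const.indicator hB).comp ?_
    exact ((hσmeas b).comp measurable_fst).inv.mul ((measurable_pi_apply b).comp measurable_snd)
  -- (2a) `∫ Φ(a, U) dU = 1_Comm(a) · c ^ #bonds`
  have hΦU : ∀ a : Fin P.d → G, ∫ U, Φ a U ∂(fieldMeasure P 0 G) = Comm.indicator (fun _ => (1 : ℝ)) a * c ^ Fintype.card (PBond P 0) := by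
    intro a
    rw [hΦ]
    show (∫ U : PBond P 0 → G, Comm.indicator (fun _ => (1 : ℝ)) a * ∏ b, B.indicator (fun _ => (1 : ℝ)) ((σ b a)⁻¹ * U b)
      ∂(Measure.pi fun _ : PBond P 0 => (HaarData.haar : Measure G))) = _
    rw [integral_const_mul]
    congr 1
    rw [integral_fintype_prod_eq_prod (fun (b : PBond P 0) (w : G) => B.indicator (fun _ => (1 : ℝ)) ((σ b a)⁻¹ * w))]
    simp_rw [integral_indicator_mul_left_eq_haarReal hB]
    rw [Finset.prod_const, Finset.card_univ]
  -- (2b) `∫ Φ(a, U) da ≤ c ^ d` (the corner bonds `⟨c*, e_k⟩` all wrap)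
  have hσcorner : ∀ (k : Fin P.d) (a : Fin P.d → G), σ ⟨fun _ => -1, k⟩ a = a k := fun k a => by simp [hσ]
  have hΦa : ∀ U : GaugeField P 0 G, ∫ a, Φ a U ∂μd ≤ c ^ P.d := by
    intro U
    have hle : ∀ a, Φ a U ≤ ∏ k : Fin P.d, B.indicator (fun _ => (1 : ℝ)) ((a k)⁻¹ * U ⟨fun _ => -1, k⟩) := by
      intro a
      set S : Finset (PBond P 0) := Finset.univ.image fun k : Fin P.d => (⟨fun _ => -1, k⟩ : PBond P 0) with hSdef
      calc Φ a U ≤ ∏ b, B.indicator (fun _ => (1 : ℝ)) ((σ b a)⁻¹ * U b) := by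
            rw [hΦ]; exact mul_le_of_le_one_left (hprod_nn a U) (hind_le a)
        _ = (∏ b ∈ S, B.indicator (fun _ => (1 : ℝ)) ((σ b a)⁻¹ * U b)) *
              ∏ b ∈ Sᶜ, B.indicator (fun _ => (1 : ℝ)) ((σ b a)⁻¹ * U b) := (Finset.prod_mul_prod_compl S _).symm
        _ ≤ (∏ b ∈ S, B.indicator (fun _ => (1 : ℝ)) ((σ b a)⁻¹ * U b)) * 1 := by
            refine mul_le_mul_of_nonneg_left ?_ (Finset.prod_nonneg fun b _ => Set.indicator_nonneg (fun _ _ => zero_le_one) _)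
            exact Finset.prod_le_one (fun b _ => Set.indicator_nonneg (fun _ _ => zero_le_one) _)
              fun b _ => Set.indicator_le_self' (fun _ _ => zero_le_one) _
        _ = ∏ k : Fin P.d, B.indicator (fun _ => (1 : ℝ)) ((a k)⁻¹ * U ⟨fun _ => -1, k⟩) := by
            rw [mul_one, hSdef]
            rw [Finset.prod_image (fun k _ k' _ h => congrArg PBond.dir h)]
            refine Finset.prod_congr rfl fun k _ => ?_
            rw [hσcorner]
    calc ∫ a, Φ a U ∂μd ≤ ∫ a, ∏ k : Fin P.d, B.indicator (fun _ => (1 : ℝ)) ((a k)⁻¹ * U ⟨fun _ => -1, k⟩) ∂μd := by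
          refine integral_mono_of_nonneg (Filter.Eventually.of_forall fun a => hΦnn a U) ?_ (Filter.Eventually.of_forall hle)
          refine Integrable.of_bound (Finset.measurable_prod _ fun k _ =>
            (measurable_const.indicator hB).comp ((measurable_pi_apply k).inv.mul_const _)).aestronglyMeasurable 1
            (Filter.Eventually.of_forall fun a => ?_)
          rw [Real.norm_eq_abs, abs_of_nonneg (Finset.prod_nonneg fun k _ => Set.indicator_nonneg (fun _ _ => zero_le_one) _)]
          exact Finset.prod_le_one (fun k _ => Set.indicator_nonneg (fun _ _ => zero_le_one) _)
            fun k _ => Set.indicator_le_self' (fun _ _ => zero_le_one) _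
      _ = c ^ P.d := by
          rw [hμd, integral_fintype_prod_eq_prod (fun (k : Fin P.d) (w : G) => B.indicator (fun _ => (1 : ℝ)) (w⁻¹ * U ⟨fun _ => -1, k⟩))]
          simp_rw [integral_indicator_inv_mul_eq_haarReal hB]
          rw [Finset.prod_const, Finset.card_univ, Fintype.card_fin]
  -- (2c) on the support of `Φ(a, ·)`: the action bound, and the tree indicators are `1`
  have hΦbox : ∀ (a : Fin P.d → G) (U : GaugeField P 0 G), Φ a U ≠ 0 → a ∈ Comm ∧ ∀ b, (σ b a)⁻¹ * U b ∈ B := by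
    intro a U hne
    have ha : a ∈ Comm := by
      by_contra h
      exact hne (by rw [hΦ]; simp [Set.indicator_of_notMem h])
    refine ⟨ha, fun b => ?_⟩
    by_contra hb
    exact hne (by rw [hΦ]; exact mul_eq_zero_of_right _ (Finset.prod_eq_zero (Finset.mem_univ b) (Set.indicator_of_notMem hb _)))
  set κ : ℝ := Real.exp (-(β * (25 / 2 * τ ^ 2 * Fintype.card (Plaq P 0)))) with hκ
  have hpt : ∀ (a : Fin P.d → G) (U : GaugeField P 0 G), κ * Φ a U ≤ (boltzmann P β U * ∏ b ∈ Tr, B.indicator (fun _ => (1 : ℝ)) (U b)) * Φ a U := by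
    intro a U
    by_cases hz : Φ a U = 0
    · rw [hz, mul_zero, mul_zero]
    · obtain ⟨ha, hall⟩ := hΦbox a U hz
      have htree : ∏ b ∈ Tr, B.indicator (fun _ => (1 : ℝ)) (U b) = 1 := by
        refine Finset.prod_eq_one fun b hb => ?_
        have hval : (b.src b.dir).val < P.sitesPerDir 0 - 1 := (Finset.mem_filter.1 hb).2.2
        have hne : b.src b.dir ≠ -1 := by
          intro h
          have h1n : 1 < P.sitesPerDir 0 := by
            unfold Params.sitesPerDir
            have := Nat.one_le_pow (P.m + P.K - 0) P.L P.L_pos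
            omega
          haveI : Fact (1 < P.sitesPerDir 0) := ⟨h1n⟩
          have h0 : (b.src b.dir + 1).val = 0 := by rw [h, neg_add_cancel, ZMod.val_zero]
          rw [ZMod.val_add, ZMod.val_one] at h0
          have hdvd : P.sitesPerDir 0 ∣ (b.src b.dir).val + 1 := Nat.dvd_of_mod_eq_zero h0
          have hle := Nat.le_of_dvd (Nat.succ_pos _) hdvd
          omega
        have := hall b
        simp only [hσ, if_neg hne, inv_one, one_mul] at this
        simp [Set.indicator_of_mem this]
      rw [htree, mul_one]
      refine mul_le_mul_of_nonneg_right ?_ (hΦnn a U)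
      rw [hκ, boltzmann]
      refine Real.exp_le_exp.2 ?_
      have hA := wilsonAction4_le_of_commBox N a (fun k l => ha k l) (U := U) (τ := τ) (by simpa [hσ] using hall)
      nlinarith
  -- (3) Tonelli
  have hint_prod : Integrable (Function.uncurry Φ) (μd.prod (fieldMeasure P 0 G)) := by
    refine Integrable.of_bound hΦmeas.aestronglyMeasurable 1 (Filter.Eventually.of_forall fun q => ?_)
    show ‖Φ q.1 q.2‖ ≤ 1
    rw [Real.norm_eq_abs, abs_of_nonneg (hΦnn q.1 q.2)]
    exact hΦle q.1 q.2
  have hswap := integral_integral_swap hint_prod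
  have hL : ∫ a, ∫ U, Φ a U ∂(fieldMeasure P 0 G) ∂μd = μd.real Comm * c ^ Fintype.card (PBond P 0) := by
    simp_rw [hΦU]
    rw [integral_mul_const]
    congr 1
    exact integral_indicator_one hCommM
  have hW_meas : Measurable fun U : GaugeField P 0 G => ∏ b ∈ Tr, B.indicator (fun _ => (1 : ℝ)) (U b) :=
    Finset.measurable_prod _ fun b _ => (measurable_const.indicator hB).comp (measurable_pi_apply b)
  have hW_bdd : ∀ U : GaugeField P 0 G, ‖∏ b ∈ Tr, B.indicator (fun _ => (1 : ℝ)) (U b)‖ ≤ 1 := by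
    intro U
    rw [Real.norm_eq_abs, Finset.abs_prod]
    refine Finset.prod_le_one (fun b _ => abs_nonneg _) fun b _ => ?_
    rw [abs_of_nonneg (Set.indicator_nonneg (fun _ _ => zero_le_one) _)]
    exact Set.indicator_le_self' (fun _ _ => zero_le_one) _
  have hWint : Integrable (fun U : GaugeField P 0 G => boltzmann P β U * ∏ b ∈ Tr, B.indicator (fun _ => (1 : ℝ)) (U b))
      (fieldMeasure P 0 G) :=
    (integrable_boltzmann RegularGaugeGroup.measurable_reTr P hβ0.le (G := G)).mul_of_top_left
      (memLp_top_of_bound hW_meas.aestronglyMeasurable 1 (Filter.Eventually.of_forall hW_bdd))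
  have hWnn : ∀ U : GaugeField P 0 G, 0 ≤ boltzmann P β U * ∏ b ∈ Tr, B.indicator (fun _ => (1 : ℝ)) (U b) := fun U =>
    mul_nonneg (boltzmann_pos P β U).le (Finset.prod_nonneg fun b _ => Set.indicator_nonneg (fun _ _ => zero_le_one) _)
  have hmain : κ * (μd.real Comm * c ^ Fintype.card (PBond P 0)) ≤ c ^ P.d * (c ^ Tr.card * partitionFn (G := G) P β) := by
    have hia : ∀ U : GaugeField P 0 G, Integrable (fun a => Φ a U) μd := fun U =>
      Integrable.of_bound ((hΦmeas.comp (measurable_id.prodMk measurable_const)).aestronglyMeasurable) 1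
        (Filter.Eventually.of_forall fun a => by
          show ‖Φ a U‖ ≤ 1
          rw [Real.norm_eq_abs, abs_of_nonneg (hΦnn a U)]; exact hΦle a U)
    have hptU : ∀ U : GaugeField P 0 G, κ * ∫ a, Φ a U ∂μd ≤
        (boltzmann P β U * ∏ b ∈ Tr, B.indicator (fun _ => (1 : ℝ)) (U b)) * c ^ P.d := by
      intro U
      calc κ * ∫ a, Φ a U ∂μd = ∫ a, κ * Φ a U ∂μd := (integral_const_mul κ _).symm
        _ ≤ ∫ a, (boltzmann P β U * ∏ b ∈ Tr, B.indicator (fun _ => (1 : ℝ)) (U b)) * Φ a U ∂μd :=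
            integral_mono ((hia U).const_mul κ) ((hia U).const_mul _) fun a => hpt a U
        _ = (boltzmann P β U * ∏ b ∈ Tr, B.indicator (fun _ => (1 : ℝ)) (U b)) * ∫ a, Φ a U ∂μd := integral_const_mul _ _
        _ ≤ (boltzmann P β U * ∏ b ∈ Tr, B.indicator (fun _ => (1 : ℝ)) (U b)) * c ^ P.d :=
            mul_le_mul_of_nonneg_left (hΦa U) (hWnn U)
    calc κ * (μd.real Comm * c ^ Fintype.card (PBond P 0))
        = κ * ∫ U, ∫ a, Φ a U ∂μd ∂(fieldMeasure P 0 G) := by rw [← hL, hswap]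
      _ = ∫ U, κ * ∫ a, Φ a U ∂μd ∂(fieldMeasure P 0 G) := (integral_const_mul κ _).symm
      _ ≤ ∫ U, (boltzmann P β U * ∏ b ∈ Tr, B.indicator (fun _ => (1 : ℝ)) (U b)) * c ^ P.d ∂(fieldMeasure P 0 G) :=
          integral_mono_of_nonneg (Filter.Eventually.of_forall fun U =>
              mul_nonneg (Real.exp_nonneg _) (integral_nonneg fun a => hΦnn a U)) (hWint.mul_const _)
            (Filter.Eventually.of_forall hptU)
      _ = c ^ P.d * (c ^ Tr.card * partitionFn (G := G) P β) := by
          rw [integral_mul_const, ← hid, show partitionFn (G := G) P β = ∫ U, boltzmann P β U ∂(fieldMeasure P 0 G) from rfl]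
          ring
  -- (4) counts
  set T : ℕ := Fintype.card (Site P 0) with hT
  have hT1 : 1 ≤ T := Fintype.card_pos
  have hbonds : Fintype.card (PBond P 0) = T * P.d := T4PlaqDisjointFamilies.card_pbond P 0
  have hTr : Tr.card = T - 1 := card_combTree P 0
  have hplaq : Fintype.card (Plaq P 0) ≤ T * (P.d * P.d) := card_plaq_le P 0
  have hd1 : 1 ≤ P.d := P.hd
  have hsplit : c ^ Fintype.card (PBond P 0) = c ^ (P.d + Tr.card) * c ^ ((P.d - 1) * (T - 1)) := by
    rw [← pow_add]; congr 1
    rw [hbonds, hTr]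
    have hd' : P.d = (P.d - 1) + 1 := (Nat.sub_add_cancel hd1).symm
    have hT' : T = (T - 1) + 1 := (Nat.sub_add_cancel hT1).symm
    conv_lhs => rw [hd', hT']
    conv_rhs => rw [hd']
    simp only [Nat.add_sub_cancel]
    ring
  have hZge : κ * c ^ ((P.d - 1) * (T - 1)) * μd.real Comm ≤ partitionFn (G := G) P β := by
    have h1 : c ^ (P.d + Tr.card) * (κ * c ^ ((P.d - 1) * (T - 1)) * μd.real Comm) ≤ c ^ (P.d + Tr.card) * partitionFn (G := G) P β := by
      calc c ^ (P.d + Tr.card) * (κ * c ^ ((P.d - 1) * (T - 1)) * μd.real Comm)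
          = κ * (μd.real Comm * c ^ Fintype.card (PBond P 0)) := by rw [hsplit]; ring
        _ ≤ c ^ P.d * (c ^ Tr.card * partitionFn (G := G) P β) := hmain
        _ = c ^ (P.d + Tr.card) * partitionFn (G := G) P β := by rw [pow_add]; ring
    exact le_of_mul_le_mul_left h1 (pow_pos hcpos _)
  -- (5) the exponential prefactor
  have hexp : -(β * (25 / 2 * τ ^ 2 * Fintype.card (Plaq P 0))) = -(25 / 2 * (Fintype.card (Plaq P 0) : ℝ)) := by rw [hτsq]; field_simp
  have hplaqR : (Fintype.card (Plaq P 0) : ℝ) ≤ (T : ℝ) * ((P.d : ℝ) * (P.d : ℝ)) := by exact_mod_cast hplaq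
  have hκge : Real.exp (-(25 / 2 * (P.d : ℝ) ^ 2 * (T : ℝ))) ≤ κ := by
    rw [hκ, hexp]; exact Real.exp_le_exp.2 (by nlinarith)
  calc Real.exp (-(25 / 2 * (P.d : ℝ) ^ 2 * (T : ℝ))) * c ^ ((P.d - 1) * (T - 1)) * μd.real Comm
      ≤ κ * c ^ ((P.d - 1) * (T - 1)) * μd.real Comm :=
        mul_le_mul_of_nonneg_right (mul_le_mul_of_nonneg_right hκge (pow_nonneg hcpos.le _)) measureReal_nonneg
    _ ≤ partitionFn (G := G) P β := hZge

end LowerBound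

end Summit.QuantumFields.YangMills.Theorems.CoarseStiffnessTailSharpLowerBound

end
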